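import Literature.MathematicalPhysics.QuantumFieldTheory.QuasiLocalGaugePerturbationDecouplingVolumes
import Literature.MathematicalPhysics.QuantumFieldTheory.QuasiLocalGaugePerturbationDecouplingMarks
import Mathlib.MeasureTheory.Integral.Pi
import HarnessLib

/-!
# Quasi-local gauge-invariant perturbations, VII-e: the link-field marginals of the joint kernels (F1)

Companion ("theorems only") file of `QuasiLocalGaugePerturbationDecoupling.lean` /
`…DecouplingVolumes.lean` / `…DecouplingMarks.lean`. The marks integrate out exactly
(`decoupling_identity`): resampling the joint volume `(ΛE, ΛP)` with a boundary condition whose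
ACTIVE exterior far polymers avoid `ΛE`, the law of the link field is the DLR kernel, on the
links of `ΛE` with the exterior link field, of the DRESSED perturbation `W^{ΛP}` (near activities
+ far activities of `ΛP`):

* `integral_exp_jointEnergy_mul` — Fubini over links ⊗ marks (`measurePreserving_piFinsetUnion`),
  the mark coordinates by `integral_fintype_prod_eq_prod`, the junk coordinates of the link sites
  by reindexing (`integral_linkPart₀_eq`);
* `integral_comp_uOf_jointSpec`, `map_uOf_jointSpec` — the kernel form (integral / measure);
* `map_uOf_jointMeasure` — the full-volume form: the `U`-marginal of the joint Gibbs measure is the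
  perturbed torus measure `μ_{β,W}` (F1).

## References

* R. G. Edwards, A. D. Sokal, Phys. Rev. D 38 (1988) 2009 (marginals of joint spin/bond laws);
  H.-O. Georgii, O. Häggström, C. Maes, *The random geometry of equilibrium phases* (2001), §6.
* H.-O. Georgii, *Gibbs Measures and Phase Transitions* (2011), Def. 1.23, Def. 2.9.
-/

noncomputable section

open MeasureTheory Finset
open scoped ENNReal
open Literature.Probability.LatticeModels (glueWith glueWith_apply_mem glueWith_apply_not_mem
  measurable_glueWith Specification IsSpecification IsGibbsMeasure map_glueWith_univ_pi_hetero
  integrable_exp_of_abs_le integral_tilted_map_eq_integral_tilted_comp)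
open Literature.MathematicalPhysics.QuantumLattice

namespace Literature.MathematicalPhysics.QuantumFieldTheory

namespace QuasiLocalGaugePerturbation

variable {d N : ℕ} [NeZero N] {G : Type*} [Group G] [MeasurableSpace G] {b : ℕ}
  (W : QuasiLocalGaugePerturbation d N G b)
  [TopologicalSpace G] [IsTopologicalGroup G] [CompactSpace G] [BorelSpace G]
  {Nρ : ℕ} (ρ : G →* Matrix (Fin Nρ) (Fin Nρ) ℂ) (hρ : Continuous ρ) [SecondCountableTopology G]

omit [TopologicalSpace G] [IsTopologicalGroup G] [CompactSpace G] [BorelSpace G]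
  [SecondCountableTopology G] in
/-- The energy of a configuration with the marks of `M` glued: a base term plus the site terms
of the glued marks. [folklore] -/
theorem exp_jointEnergy_glueWith_marks (β : ℝ) (M : Finset (FarPoly b d N))
    (ξ : JSite b d N → G × Bool) (u : ↥(M.map (marksEmb b d N)) → G × Bool) :
    Real.exp (W.jointEnergy ρ β (glueWith (M.map (marksEmb b d N)) u ξ)) =
      Real.exp ((-β * wilsonAction ρ (uOf ξ) - (W.restrict fun X => X.card = 1).total (uOf ξ)) +
        ∑ v ∈ (M.map (marksEmb b d N))ᶜ, W.siteTerm (uOf ξ) v (ξ v)) *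
      ∏ v : ↥(M.map (marksEmb b d N)), Real.exp (W.siteTerm (uOf ξ) v.1 (u v)) := by
  rw [jointEnergy_eq, uOf_glueWith_map_inr, ← Finset.sum_add_sum_compl (M.map (marksEmb b d N)),
    show (-β * wilsonAction ρ (uOf ξ) - (W.restrict fun X => X.card = 1).total (uOf ξ)) +
        (∑ v ∈ M.map (marksEmb b d N), W.siteTerm (uOf ξ) v (glueWith (M.map (marksEmb b d N)) u ξ v) +
          ∑ v ∈ (M.map (marksEmb b d N))ᶜ,
            W.siteTerm (uOf ξ) v (glueWith (M.map (marksEmb b d N)) u ξ v)) =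
        ((-β * wilsonAction ρ (uOf ξ) - (W.restrict fun X => X.card = 1).total (uOf ξ)) +
          ∑ v ∈ (M.map (marksEmb b d N))ᶜ,
            W.siteTerm (uOf ξ) v (glueWith (M.map (marksEmb b d N)) u ξ v)) +
          ∑ v ∈ M.map (marksEmb b d N),
            W.siteTerm (uOf ξ) v (glueWith (M.map (marksEmb b d N)) u ξ v) by ring]
  have hout : ∑ v ∈ (M.map (marksEmb b d N))ᶜ,
      W.siteTerm (uOf ξ) v (glueWith (M.map (marksEmb b d N)) u ξ v) =
      ∑ v ∈ (M.map (marksEmb b d N))ᶜ, W.siteTerm (uOf ξ) v (ξ v) :=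
    Finset.sum_congr rfl fun v hv => by rw [glueWith_apply_not_mem _ _ _ (Finset.mem_compl.1 hv)]
  have hin : ∑ v ∈ M.map (marksEmb b d N),
      W.siteTerm (uOf ξ) v (glueWith (M.map (marksEmb b d N)) u ξ v) =
      ∑ v : ↥(M.map (marksEmb b d N)), W.siteTerm (uOf ξ) v.1 (u v) := by
    rw [← Finset.sum_coe_sort]
    exact Finset.sum_congr rfl fun v _ => by rw [glueWith_apply_mem _ _ _ v.2]
  rw [hout, hin, Real.exp_add, Real.exp_sum]

/-- Integrating out glued marks: `∫ ∏_X exp(siteTerm) = ∏_{X ∈ M} e^{s_X - W_X(U)}`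
(`decoupling_identity`). [folklore] -/
theorem integral_prod_exp_siteTerm (M : Finset (FarPoly b d N)) (U : GaugeConfig d N G) :
    ∫ z, ∏ v : ↥(M.map (marksEmb b d N)), Real.exp (W.siteTerm U v.1 (z v))
        ∂(Measure.pi fun v : ↥(M.map (marksEmb b d N)) => W.jointRef v) =
      ∏ X ∈ M, Real.exp (W.supNorm X.1 - W.act X.1 U) := by
  rw [integral_fintype_prod_eq_prod (𝕜 := ℝ)
    (fun (v : ↥(M.map (marksEmb b d N))) (s : G × Bool) => Real.exp (W.siteTerm U v.1 s)),
    Finset.prod_coe_sort (M.map (marksEmb b d N))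
      (fun v => ∫ s, Real.exp (W.siteTerm U v s) ∂(W.jointRef v)), Finset.prod_map]
  refine Finset.prod_congr rfl fun X _ => ?_
  rw [marksEmb_apply, W.integral_exp_siteTerm_inr X U, decoupling_identity]

/-- **The reference measure of the link sites, read on the link variables, is product Haar**:
`linkPart₀` pushes `⊗_{v} (Haar ⊗ δ_false)` to `Haar^{⊗ ΛE}`. [folklore] -/
theorem integral_linkPart₀_eq (ΛE : Finset (Edge d N)) {Φ : (↥ΛE → G) → ℝ}
    (hΦ : Measurable Φ) :
    ∫ y, Φ (linkPart₀ ΛE y) ∂(Measure.pi fun v : ↥(ΛE.map (linksEmb b d N)) => W.jointRef v) =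
      ∫ w, Φ w ∂(Measure.pi fun _ : ↥ΛE => haarProbability G) := by
  classical
  set e := linksEquiv (b := b) ΛE with he
  -- reindex along `e`, then drop the junk coordinates
  have h1 : (Measure.pi fun v : ↥(ΛE.map (linksEmb b d N)) => W.jointRef v) =
      Measure.pi fun v : ↥(ΛE.map (linksEmb b d N)) =>
        (fun _ : ↥ΛE => (haarProbability G).prod (Measure.dirac false)) (e.symm v) := by
    congr 1
    funext v
    obtain ⟨e', -, hev⟩ := Finset.mem_map.1 v.2
    rw [show W.jointRef v.1 = W.jointRef (Sum.inl e') by rw [← hev]; rfl]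
    rfl
  have hmp := measurePreserving_piCongrLeft
    (fun _ : ↥ΛE => (haarProbability G).prod (Measure.dirac false)) e.symm
  have hlink : ∀ y : ↥(ΛE.map (linksEmb b d N)) → G × Bool, linkPart₀ ΛE y =
      fun i => ((MeasurableEquiv.piCongrLeft (fun _ : ↥ΛE => G × Bool) e.symm) y i).1 := by
    intro y
    funext i
    have h := Equiv.piCongrLeft_apply_apply (fun _ : ↥ΛE => G × Bool) e.symm y (e i)
    rw [e.symm_apply_apply] at h
    rw [MeasurableEquiv.coe_piCongrLeft, h]
    rfl
  simp_rw [hlink]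
  rw [h1]
  rw [hmp.integral_comp' (g := fun w : ↥ΛE → G × Bool => Φ fun i => (w i).1)]
  -- coordinatewise first projection
  have hfst : (Measure.pi fun _ : ↥ΛE => (haarProbability G).prod (Measure.dirac false)).map
      (fun (w : ↥ΛE → G × Bool) i => (w i).1) = Measure.pi fun _ : ↥ΛE => haarProbability G := by
    rw [Measure.pi_map_pi (fun _ => measurable_fst.aemeasurable)]
    congr 1
    funext i
    rw [Measure.map_fst_prod, measure_univ, one_smul]
  have hmeas : Measurable (fun (w : ↥ΛE → G × Bool) (i : ↥ΛE) => (w i).1) :=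
    measurable_pi_lambda (fun (w : ↥ΛE → G × Bool) (i : ↥ΛE) => (w i).1) fun i =>
      measurable_fst.comp (measurable_pi_apply i)
  rw [← hfst, integral_map hmeas.aemeasurable hΦ.aestronglyMeasurable]




omit [TopologicalSpace G] [IsTopologicalGroup G] [CompactSpace G] [BorelSpace G]
  [SecondCountableTopology G] ρ in
/-- The exterior site terms do not see the glued links, provided the active exterior far
polymers avoid `ΛE`. [folklore] -/
theorem sum_siteTerm_exterior_eq (ΛE : Finset (Edge d N)) (ΛP : Finset (FarPoly b d N))
    (ξ : JSite b d N → G × Bool)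
    (hNC : ∀ X : FarPoly b d N, X ∉ ΛP → (∃ e ∈ ΛE, e ∈ polymerEdges b X.1) → markOf ξ X = false)
    (w : ↥ΛE → G) (y : ↥(ΛE.map (linksEmb b d N)) → G × Bool) :
    ∑ v ∈ (ΛP.map (marksEmb b d N))ᶜ,
        W.siteTerm (glueWith ΛE w (uOf ξ)) v (glueWith (ΛE.map (linksEmb b d N)) y ξ v) =
      ∑ v ∈ (ΛP.map (marksEmb b d N))ᶜ, W.siteTerm (uOf ξ) v (ξ v) := by
  refine Finset.sum_congr rfl fun v hv => ?_
  rcases v with e | X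
  · simp [siteTerm]
  · have hX : X ∉ ΛP := fun h => Finset.mem_compl.1 hv (Finset.mem_map_of_mem _ h)
    have hv' : Sum.inr X ∉ ΛE.map (linksEmb b d N) := fun h => by
      obtain ⟨e, -, he⟩ := Finset.mem_map.1 h; simp at he
    rw [glueWith_apply_not_mem _ _ _ hv']
    by_cases hact : markOf ξ X = true
    · have htouch : ¬ ∃ e ∈ ΛE, e ∈ polymerEdges b X.1 := fun h => by
        have := hNC X hX h; rw [this] at hact; exact Bool.false_ne_true hact
      push Not at htouch
      have hactX : W.act X.1 (glueWith ΛE w (uOf ξ)) = W.act X.1 (uOf ξ) :=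
        W.dependsOn X.1 fun e he => by
          have heΛ : e ∉ ΛE := fun h => htouch e h (Finset.mem_coe.1 he)
          rw [glueWith_apply_not_mem _ _ _ heΛ]
      simp only [siteTerm, Sum.elim_inr, hTilt, hactX]
    · simp only [markOf, Bool.not_eq_true] at hact
      simp [siteTerm, hact]

include hρ in
/-- **Integrating out the marks and the junk coordinates of a joint volume**: against the glued
reference measure of the joint volume `(ΛE, ΛP)`, `exp(jointEnergy) · F'(U)` integrates to a
constant times the integral of `exp(-β S_W - W^{ΛP}) · F'` against the glued product Haar measure
of the links of `ΛE` (`W^{ΛP}` the dressed perturbation), provided the active exterior far polymers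
avoid `ΛE`. [folklore] -/
theorem integral_exp_jointEnergy_mul (β : ℝ) (ΛE : Finset (Edge d N))
    (ΛP : Finset (FarPoly b d N)) (ξ : JSite b d N → G × Bool)
    (hNC : ∀ X : FarPoly b d N, X ∉ ΛP → (∃ e ∈ ΛE, e ∈ polymerEdges b X.1) → markOf ξ X = false)
    {F' : GaugeConfig d N G → ℝ} (hF'm : Measurable F') (hF'01 : ∀ U, 0 ≤ F' U ∧ F' U ≤ 1) :
    ∫ w, Real.exp (W.jointEnergy ρ β
          (glueWith (ΛE.map (linksEmb b d N) ∪ ΛP.map (marksEmb b d N)) w ξ)) *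
        F' (uOf (glueWith (ΛE.map (linksEmb b d N) ∪ ΛP.map (marksEmb b d N)) w ξ))
        ∂(Measure.pi fun v : ↥(ΛE.map (linksEmb b d N) ∪ ΛP.map (marksEmb b d N)) =>
          W.jointRef v) =
      Real.exp ((∑ v ∈ (ΛP.map (marksEmb b d N))ᶜ, W.siteTerm (uOf ξ) v (ξ v)) +
          ∑ X ∈ ΛP, W.supNorm X.1) *
        ∫ w, Real.exp (-β * wilsonAction ρ (glueWith ΛE w (uOf ξ)) -
            (W.dressed ΛP).total (glueWith ΛE w (uOf ξ))) * F' (glueWith ΛE w (uOf ξ))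
          ∂(Measure.pi fun _ : ↥ΛE => haarProbability G) := by
  classical
  have hst := disjoint_links_marks (b := b) ΛE ΛP
  have hφm := W.measurable_jointEnergy ρ hρ (b := b) β
  obtain ⟨C, hC⟩ := W.exists_abs_jointEnergy_le ρ hρ (b := b) β
  -- the integrand and its pull-back along the two-step gluing
  set g : (↥(ΛE.map (linksEmb b d N) ∪ ΛP.map (marksEmb b d N)) → G × Bool) → ℝ := fun w =>
    Real.exp (W.jointEnergy ρ β
        (glueWith (ΛE.map (linksEmb b d N) ∪ ΛP.map (marksEmb b d N)) w ξ)) *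
      F' (uOf (glueWith (ΛE.map (linksEmb b d N) ∪ ΛP.map (marksEmb b d N)) w ξ)) with hg
  have hgm : Measurable g :=
    ((hφm.comp (measurable_glueWith _ ξ)).exp).mul
      (hF'm.comp (measurable_uOf.comp (measurable_glueWith _ ξ)))
  have hgb : ∀ w, ‖g w‖ ≤ Real.exp C := fun w => by
    rw [Real.norm_eq_abs, hg, abs_mul, Real.abs_exp, abs_of_nonneg (hF'01 _).1]
    calc _ ≤ Real.exp C * 1 := mul_le_mul (Real.exp_le_exp.2 ((le_abs_self _).trans (hC _)))
          (hF'01 _).2 (hF'01 _).1 (Real.exp_pos C).le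
      _ = Real.exp C := mul_one _
  -- split the product reference measure: links ⊗ marks
  have hmp := measurePreserving_piFinsetUnion hst (fun v : JSite b d N => W.jointRef v)
  rw [← hmp.integral_comp' g]
  have hint : Integrable (fun p => g (MeasurableEquiv.piFinsetUnion (fun _ => G × Bool) hst p))
      ((Measure.pi fun v : ↥(ΛE.map (linksEmb b d N)) => W.jointRef v).prod
        (Measure.pi fun v : ↥(ΛP.map (marksEmb b d N)) => W.jointRef v)) :=
    Integrable.of_bound ((hgm.comp (MeasurableEquiv.measurable _)).aestronglyMeasurable)
      (Real.exp C) (ae_of_all _ fun p => hgb _)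
  rw [integral_prod _ hint]
  -- the inner integral over the marks
  have hinner : ∀ y : ↥(ΛE.map (linksEmb b d N)) → G × Bool,
      ∫ z, g (MeasurableEquiv.piFinsetUnion (fun _ => G × Bool) hst (y, z))
        ∂(Measure.pi fun v : ↥(ΛP.map (marksEmb b d N)) => W.jointRef v) =
      Real.exp ((∑ v ∈ (ΛP.map (marksEmb b d N))ᶜ, W.siteTerm (uOf ξ) v (ξ v)) +
          ∑ X ∈ ΛP, W.supNorm X.1) *
        (Real.exp (-β * wilsonAction ρ (glueWith ΛE (linkPart₀ ΛE y) (uOf ξ)) -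
            (W.dressed ΛP).total (glueWith ΛE (linkPart₀ ΛE y) (uOf ξ))) *
          F' (glueWith ΛE (linkPart₀ ΛE y) (uOf ξ))) := by
    intro y
    simp only [hg, glueWith_union_piFinsetUnion, uOf_glueWith_map_inr, exp_jointEnergy_glueWith_marks,
      uOf_glueWith_links]
    rw [W.sum_siteTerm_exterior_eq ΛE ΛP ξ hNC (linkPart₀ ΛE y) y]
    have hrw : ∀ z : ↥(ΛP.map (marksEmb b d N)) → G × Bool,
        Real.exp ((-β * wilsonAction ρ (glueWith ΛE (linkPart₀ ΛE y) (uOf ξ)) -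
            (W.restrict fun X => X.card = 1).total (glueWith ΛE (linkPart₀ ΛE y) (uOf ξ))) +
            ∑ v ∈ (ΛP.map (marksEmb b d N))ᶜ, W.siteTerm (uOf ξ) v (ξ v)) *
          (∏ v : ↥(ΛP.map (marksEmb b d N)),
            Real.exp (W.siteTerm (glueWith ΛE (linkPart₀ ΛE y) (uOf ξ)) v.1 (z v))) *
          F' (glueWith ΛE (linkPart₀ ΛE y) (uOf ξ)) =
        (Real.exp ((-β * wilsonAction ρ (glueWith ΛE (linkPart₀ ΛE y) (uOf ξ)) -
            (W.restrict fun X => X.card = 1).total (glueWith ΛE (linkPart₀ ΛE y) (uOf ξ))) +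
            ∑ v ∈ (ΛP.map (marksEmb b d N))ᶜ, W.siteTerm (uOf ξ) v (ξ v)) *
          F' (glueWith ΛE (linkPart₀ ΛE y) (uOf ξ))) *
          ∏ v : ↥(ΛP.map (marksEmb b d N)),
            Real.exp (W.siteTerm (glueWith ΛE (linkPart₀ ΛE y) (uOf ξ)) v.1 (z v)) :=
      fun z => by ring
    simp_rw [hrw]
    rw [integral_const_mul, integral_prod_exp_siteTerm, ← Real.exp_sum, total_dressed]
    simp only [Real.exp_add, Real.exp_sub, Finset.sum_sub_distrib, Real.exp_sum]
    have hZ : ∏ X ∈ ΛP, Real.exp (W.act X.1 (glueWith ΛE (linkPart₀ ΛE y) (uOf ξ))) ≠ 0 :=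
      Finset.prod_ne_zero_iff.2 fun X _ => (Real.exp_pos _).ne'
    field_simp
  simp_rw [hinner]
  rw [integral_const_mul]
  congr 1
  exact W.integral_linkPart₀_eq ΛE
    (Φ := fun w => Real.exp (-β * wilsonAction ρ (glueWith ΛE w (uOf ξ)) -
      (W.dressed ΛP).total (glueWith ΛE w (uOf ξ))) * F' (glueWith ΛE w (uOf ξ)))
    ((((measurable_action ρ hρ β (W.dressed ΛP)).comp (measurable_glueWith ΛE (uOf ξ))).exp).mul
      (hF'm.comp (measurable_glueWith ΛE (uOf ξ))))

omit [TopologicalSpace G] [IsTopologicalGroup G] [CompactSpace G] [BorelSpace G]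
  [SecondCountableTopology G] [Group G] [MeasurableSpace G] W ρ in
/-- Integration against a tilted measure as a ratio. [folklore] -/
theorem integral_tilted_eq_div {Y : Type*} [MeasurableSpace Y] (π : Measure Y) (Φ g : Y → ℝ) :
    ∫ y, g y ∂(π.tilted Φ) = (∫ y, Real.exp (Φ y) * g y ∂π) / ∫ y, Real.exp (Φ y) ∂π := by
  rw [integral_tilted]
  simp_rw [smul_eq_mul, div_mul_eq_mul_div]
  rw [integral_div]

include hρ in
/-- **The link-field marginal of a joint kernel is a dressed kernel (F1, kernel form).**
Resampling the links of `ΛE` and the marks of `ΛP` with boundary condition `ξ` whose active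
exterior far polymers avoid `ΛE`, the law of the link field is the DLR kernel on `ΛE`, with
exterior `U(ξ)`, of the perturbation `W^{ΛP}` = near activities + far activities of `ΛP`
(the marks of `ΛP` integrate out by `decoupling_identity`). [folklore] -/
theorem integral_comp_uOf_jointSpec (β : ℝ) (ΛE : Finset (Edge d N))
    (ΛP : Finset (FarPoly b d N)) (ξ : JSite b d N → G × Bool)
    (hNC : ∀ X : FarPoly b d N, X ∉ ΛP → (∃ e ∈ ΛE, e ∈ polymerEdges b X.1) → markOf ξ X = false)
    {F : GaugeConfig d N G → ℝ} (hF : Measurable F) (hF01 : ∀ U, 0 ≤ F U ∧ F U ≤ 1) :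
    ∫ σ, F (uOf σ) ∂(W.jointSpec ρ β (ΛE.map (linksEmb b d N) ∪ ΛP.map (marksEmb b d N)) ξ) =
      ∫ U, F U ∂((W.dressed ΛP).kernel ρ β ΛE (uOf ξ)) := by
  have hφm := W.measurable_jointEnergy ρ hρ (b := b) β
  have hψm := measurable_action ρ hρ β (W.dressed ΛP)
  -- left-hand side as a ratio
  simp only [jointSpec]
  rw [integral_tilted_map_eq_integral_tilted_comp _ (measurable_glueWith _ ξ) hφm
    (f := fun σ => F (uOf σ)) (hF.comp measurable_uOf), integral_tilted_eq_div]
  simp only [Function.comp_def]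
  rw [W.integral_exp_jointEnergy_mul ρ hρ β ΛE ΛP ξ hNC hF hF01]
  have h1 := W.integral_exp_jointEnergy_mul ρ hρ β ΛE ΛP ξ hNC (F' := fun _ => (1 : ℝ))
    measurable_const (fun _ => ⟨zero_le_one, le_rfl⟩)
  simp only [mul_one] at h1
  rw [h1, mul_div_mul_left _ _ (Real.exp_pos _).ne']
  -- right-hand side as a ratio
  simp only [kernel]
  rw [integral_tilted_map_eq_integral_tilted_comp _ (measurable_glueWith ΛE (uOf ξ)) hψm hF,
    integral_tilted_eq_div]
  simp only [Function.comp_def]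

include hρ in
/-- **The link-field marginal of a joint kernel is a dressed kernel (F1, measure form).**
[folklore] -/
theorem map_uOf_jointSpec [MeasurableSingletonClass G] (β : ℝ) (ΛE : Finset (Edge d N))
    (ΛP : Finset (FarPoly b d N)) (ξ : JSite b d N → G × Bool)
    (hNC : ∀ X : FarPoly b d N, X ∉ ΛP → (∃ e ∈ ΛE, e ∈ polymerEdges b X.1) → markOf ξ X = false) :
    (W.jointSpec ρ β (ΛE.map (linksEmb b d N) ∪ ΛP.map (marksEmb b d N)) ξ).map uOf =
      (W.dressed ΛP).kernel ρ β ΛE (uOf ξ) := by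
  haveI := (W.isSpecification_jointSpec ρ hρ (b := b) β).isProbability
    (ΛE.map (linksEmb b d N) ∪ ΛP.map (marksEmb b d N)) ξ
  haveI := (isSpecification_and_isGibbsMeasure_perturbedMeasure ρ hρ β
    (W.dressed ΛP)).1.isProbability ΛE (uOf ξ)
  refine Measure.ext fun A hA => ?_
  rw [Measure.map_apply measurable_uOf hA]
  have h := W.integral_comp_uOf_jointSpec ρ hρ β ΛE ΛP ξ hNC (F := A.indicator 1)
    (measurable_one.indicator hA) (fun U => by by_cases hU : U ∈ A <;> simp [hU])
  have hind : (fun σ : JSite b d N → G × Bool => A.indicator (1 : GaugeConfig d N G → ℝ) (uOf σ)) =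
      (uOf ⁻¹' A).indicator 1 := by
    funext σ; by_cases hσ : uOf σ ∈ A <;> simp [hσ, Set.indicator]
  rw [hind, integral_indicator_one (measurable_uOf hA), integral_indicator_one hA] at h
  simp only [kernel] at h ⊢
  rw [← ofReal_measureReal (measure_ne_top _ _), ← ofReal_measureReal (measure_ne_top _ _), h]



include hρ in
/-- **The link-field marginal of the joint Gibbs measure is the perturbed torus measure (F1).**
[folklore] -/
theorem map_uOf_jointMeasure [MeasurableSingletonClass G] (β : ℝ) :
    (W.jointMeasure ρ β (b := b)).map uOf = W.perturbedMeasure ρ β := by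
  let ξ₀ : JSite b d N → G × Bool := fun _ => ((1 : G), false)
  have hNC : ∀ X : FarPoly b d N, X ∉ (Finset.univ : Finset (FarPoly b d N)) →
      (∃ e ∈ (Finset.univ : Finset (Edge d N)), e ∈ polymerEdges b X.1) → markOf ξ₀ X = false :=
    fun X hX => absurd (Finset.mem_univ X) hX
  have h := W.map_uOf_jointSpec ρ hρ β Finset.univ Finset.univ ξ₀ hNC
  rw [← univ_eq_links_union_marks, jointSpec_univ] at h
  rw [h]
  -- the full-volume dressed kernel is the perturbed measure
  simp only [kernel]
  rw [map_glueWith_univ_pi, perturbedMeasure_eq_tilted ρ hρ β W]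
  set π : Measure (GaugeConfig d N G) := Measure.pi fun _ : Edge d N => haarProbability G with hπ
  haveI : IsProbabilityMeasure π := by rw [hπ]; infer_instance
  have hint : Integrable (fun U => Real.exp (-β * wilsonAction ρ U - W.total U)) π :=
    integrable_exp_of_abs_le π (measurable_action ρ hρ β W) (exists_abs_action_le ρ hρ β W)
  set c : ℝ := W.total 1 - (W.dressed (Finset.univ : Finset (FarPoly b d N))).total 1 with hc
  have hshift : (fun U : GaugeConfig d N G => -β * wilsonAction ρ U -
      (W.dressed (Finset.univ : Finset (FarPoly b d N))).total U) =
      (fun U => -β * wilsonAction ρ U - W.total U) + fun _ => c := by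
    funext U
    simp only [Pi.add_apply]
    have := W.total_sub_total_dressed_univ U 1
    linarith
  haveI := isProbabilityMeasure_tilted hint
  rw [hshift, ← tilted_tilted hint, tilted_const]

end QuasiLocalGaugePerturbation

end Literature.MathematicalPhysics.QuantumFieldTheory

end
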